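import Literature.MathematicalPhysics.QuantumFieldTheory.LatticeGaugeStaticPotentialLimitProofs
import HarnessLib

/-!
# Concavity, monotonicity and the linear upper bound of the static quark potential
(Bachas 1986, Seiler 1978)

Theorem-only companion of `LatticeGaugeStaticPotentialLimitProofs` /
`StringTensionAnalysis` (inventory item constructive-qft.S12: static potential `V(R)` and string
tension `σ` of an infinite-volume limit state of the torus Wilson states). Those files export the
EXISTENCE of `V(R) = -lim_T T⁻¹ log W(R,T)` and of `σ = lim_R V(R)/R` and the LOWER bounds of the
strong-coupling area law (`osterwalder_seiler_areaLaw`). This file exports the printed UPPER-bound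
structure of `V`, for every compact gauge group `G`, every continuous finite-dimensional
representation `ρ` (character `χ = (1/N) Re tr ρ`), every `β ≥ 0`, every `d ≥ 2` and every
infinite-volume limit point `μ ∈ infiniteVolumeLimitPoints ρ β` whose rectangular Wilson loop
expectations `W(R,T) = W_μ(R × T)`, `R, T ≥ 1`, do not vanish (the hypothesis of
`exists_hasStringTension`):

* `StaticPotential.staticPotential_concave`, `…_midpoint_concave` — **Bachas 1986**:
  `V(R-r) + V(R+r) ≤ 2 V(R)` for `0 ≤ r ≤ R` ("`V` is a concave function of `R`"), from the
  reflection-positivity Schwarz inequality `W(R,T)² ≤ W(R-r,T) W(R+r,T)` in a hyperplane normal to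
  the plane of the loop [cite: Bachas1986, eq. (8) and the display following it];
* `StaticPotential.staticPotential_monotone` — **Bachas 1986**: `V` is monotone non-decreasing
  [cite: Bachas1986, (2b)] (printed proof: concave and bounded below, the lower bound there from
  the Simon–Yaffe perimeter bound; here `V ≥ 0` because `|χ| ≤ 1`);
* `StaticPotential.staticPotential_le_mul` — **Seiler 1978**: `V(R) ≤ R · V(1)`, "the (suitably
  defined) potential between color charges cannot rise faster than linearly with distance"
  [cite: Seiler1978, abstract]; Bachas: "asymptotic convexity (as `R → ∞`) was proven by E. Seiler
  … what we present here is a slight modification of his argument" [cite: Bachas1986, ref. 2];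
* consequences (folklore of the transfer-matrix formalism, Seiler LNP 159 §2): `V(0) = 0`,
  `R ↦ V(R)/R` is non-increasing on `R ≥ 1`, the string tension satisfies
  `σ ≤ V(R)/R ≤ V(1)` for every `R ≥ 1`, and — log-convexity in the time direction down to
  `T = 0` — `V(R) ≤ -log W(R,1)`, in particular `σ ≤ V(1) ≤ -log W(1,1) = -log ⟨χ(U_p)⟩_μ`
  (the string tension is bounded by minus the logarithm of the mean plaquette), together with the
  loop-level form `W(1,1)^{RT} ≤ W(R,T)` of the same inequalities.

## The proof (all in the tree)

Reflection positivity of the torus Wilson states in the lattice hyperplanes and in the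
hyperplanes between lattice planes normal to the direction `0` gives the Gram inequalities of
`ConstructiveQFTWave0WilsonLoopRPProofs` / `…OddProofs`; passed to the limit point they read
`0 ≤ W(R,T)` and `W(R+1,T)² ≤ W(R,T) W(R+2,T)` for ALL `R, T ≥ 0`
(`rectExpectation_nonneg_and_logConvex`: log-convexity in the direction-`0` extent `R`, which in
the tree's convention `HasStaticPotential` is the quark SEPARATION, the time `T` running in
direction `1`). This is exactly Bachas' inequality (8) (his reflection hyperplane is "parallel to
the time axis and normal to the plane of the Wilson loop"); with `W > 0` it gives the concavity of
`T⁻¹(-log W(·,T))`, hence of `V`, including the end point `R = 0` where `W(0,T) = 1`, `V(0) = 0`.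
A concave sequence vanishing at `0` lies below its first chord (`V(R) ≤ R V(1)`, Seiler) and has
non-increasing slopes `V(R)/R`; a non-negative concave sequence is non-decreasing. The same
log-convexity in the direction `1` (coordinate swap `0 ↔ 1`, `rectExpectation_eq_swap`) from
`T = 0` gives `W(R,1)^T ≤ W(R,T)`, i.e. `V(R) ≤ -log W(R,1)`.

Wording note for users: Seiler 1978 prints "at most linear"; the inequality "`σ ≤ -ln u`" with
`u` the one-plaquette (two-dimensional) expectation is NOT what is printed there — the
infinite-volume statement proved here is `σ(β) ≤ -log ⟨χ(U_p)⟩_{μ_β}` with the mean plaquette of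
the `d`-dimensional state itself.

## References

* C. Bachas, *Concavity of the quarkonium potential*, Phys. Rev. D 33 (1986) 2723–2725
  (preprint SLAC-PUB-3814, "Convexity of the quarkonium potential", read as printed: eqs. (2),
  (5), (7), (8)).
* E. Seiler, *Upper bound on the color-confining potential*, Phys. Rev. D 18 (1978) 482–483.
* E. Seiler, LNP 159 (1982), §2; K. Osterwalder, E. Seiler, Ann. Phys. 110 (1978) 440, §2
  (reflection positivity, transfer matrix).

Everything here is proved; no definition, no named fact. [folklore]
-/

noncomputable section

open MeasureTheory Filter Topology Finset
open Literature.MathematicalPhysics.QuantumLattice Literature.Probability.LatticeModels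

namespace Literature.MathematicalPhysics.QuantumFieldTheory

namespace StaticPotential

/-! ### (A) Real analysis: positive log-convex sequences and concave sequences -/

section RealAnalysis

/-- The successive ratios `W(n+1)/W(n)` of a positive log-convex sequence are non-decreasing.
[folklore] -/
private theorem div_monotone_of_logConvex {W : ℕ → ℝ} (hpos : ∀ n, 0 < W n)
    (hconv : ∀ n, W (n + 1) ^ 2 ≤ W n * W (n + 2)) :
    Monotone fun n => W (n + 1) / W n := by
  refine monotone_nat_of_le_succ fun n => ?_
  show W (n + 1) / W n ≤ W (n + 2) / W (n + 1)
  rw [div_le_div_iff₀ (hpos n) (hpos (n + 1))]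
  nlinarith [hconv n]

/-- A positive log-convex sequence lies above the geometric sequence through its first two
terms: `W(0) (W(1)/W(0))^n ≤ W(n)`. [folklore] -/
private theorem mul_pow_le_of_logConvex {W : ℕ → ℝ} (hpos : ∀ n, 0 < W n)
    (hconv : ∀ n, W (n + 1) ^ 2 ≤ W n * W (n + 2)) (n : ℕ) :
    W 0 * (W 1 / W 0) ^ n ≤ W n := by
  induction n with
  | zero => simp
  | succ n ih =>
    have hmono : W 1 / W 0 ≤ W (n + 1) / W n := by
      simpa using div_monotone_of_logConvex hpos hconv (Nat.zero_le n)
    have hn : W n ≠ 0 := (hpos n).ne'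
    calc W 0 * (W 1 / W 0) ^ (n + 1) = W 0 * (W 1 / W 0) ^ n * (W 1 / W 0) := by ring
      _ ≤ W n * (W (n + 1) / W n) :=
          mul_le_mul ih hmono (div_nonneg (hpos 1).le (hpos 0).le) (hpos n).le
      _ = W (n + 1) := by field_simp

/-- A positive log-convex sequence with `W(0) = 1` satisfies `W(1)^n ≤ W(n)`. [folklore] -/
private theorem pow_le_of_logConvex {W : ℕ → ℝ} (h0 : W 0 = 1) (hpos : ∀ n, 0 < W n)
    (hconv : ∀ n, W (n + 1) ^ 2 ≤ W n * W (n + 2)) (n : ℕ) : W 1 ^ n ≤ W n := by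
  simpa [h0] using mul_pow_le_of_logConvex hpos hconv n

/-- The increments of a (discretely) concave sequence are non-increasing. [folklore] -/
private theorem sub_antitone_of_concave {c : ℕ → ℝ} (hc : ∀ n, c n + c (n + 2) ≤ 2 * c (n + 1)) :
    Antitone fun n => c (n + 1) - c n := by
  refine antitone_nat_of_succ_le fun n => ?_
  show c (n + 2) - c (n + 1) ≤ c (n + 1) - c n
  linarith [hc n]

/-- **A concave sequence vanishing at `0` lies below its first chord: `c(n) ≤ n · c(1)`.**
[folklore] -/
private theorem le_mul_of_concave {c : ℕ → ℝ} (h0 : c 0 = 0)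
    (hc : ∀ n, c n + c (n + 2) ≤ 2 * c (n + 1)) (n : ℕ) : c n ≤ n * c 1 := by
  have hanti := sub_antitone_of_concave hc
  calc c n = ∑ i ∈ range n, (c (i + 1) - c i) := by rw [Finset.sum_range_sub, h0, sub_zero]
    _ ≤ ∑ _i ∈ range n, (c 1 - c 0) :=
        Finset.sum_le_sum fun i _ => by simpa using hanti (Nat.zero_le i)
    _ = n * c 1 := by rw [Finset.sum_const, Finset.card_range, nsmul_eq_mul, h0, sub_zero]

/-- **A non-negative concave sequence is non-decreasing** (a negative increment would, by
concavity, persist and drive the sequence below zero). [folklore] -/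
private theorem monotone_of_concave_nonneg {c : ℕ → ℝ} (hnn : ∀ n, 0 ≤ c n)
    (hc : ∀ n, c n + c (n + 2) ≤ 2 * c (n + 1)) : Monotone c := by
  have hanti := sub_antitone_of_concave hc
  refine monotone_nat_of_le_succ fun k => ?_
  by_contra hlt
  rw [not_le] at hlt
  set δ : ℝ := c k - c (k + 1) with hδ
  have hδpos : 0 < δ := by simp only [hδ]; linarith
  have hdec : ∀ m : ℕ, c (k + m) ≤ c k - m * δ := by
    intro m
    induction m with
    | zero => simp
    | succ m ih =>
      have h : c (k + m + 1) - c (k + m) ≤ c (k + 1) - c k := hanti (Nat.le_add_right k m)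
      rw [show k + (m + 1) = k + m + 1 by ring]
      push_cast
      linarith
  obtain ⟨m, hm⟩ := exists_nat_gt (c k / δ)
  have h1 := hdec m
  have h2 := hnn (k + m)
  have h3 : c k < m * δ := (div_lt_iff₀ hδpos).1 hm
  linarith

/-- **Midpoint concavity at distance `r`**: `c(m) + c(m + 2r) ≤ 2 c(m + r)` for a concave
sequence (the increments over `[m+r, m+2r)` are termwise below those over `[m, m+r)`).
[folklore] -/
private theorem add_le_two_mul_of_concave {c : ℕ → ℝ} (hc : ∀ n, c n + c (n + 2) ≤ 2 * c (n + 1))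
    (m r : ℕ) : c m + c (m + r + r) ≤ 2 * c (m + r) := by
  have hanti := sub_antitone_of_concave hc
  have h1 : c (m + r + r) - c (m + r) =
      ∑ i ∈ range r, (c (m + r + (i + 1)) - c (m + r + i)) := by
    rw [Finset.sum_range_sub (fun i => c (m + r + i))]
    simp
  have h2 : c (m + r) - c m = ∑ i ∈ range r, (c (m + (i + 1)) - c (m + i)) := by
    rw [Finset.sum_range_sub (fun i => c (m + i))]
    simp
  have h3 : ∑ i ∈ range r, (c (m + r + (i + 1)) - c (m + r + i)) ≤
      ∑ i ∈ range r, (c (m + (i + 1)) - c (m + i)) := by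
    refine Finset.sum_le_sum fun i _ => ?_
    have h : c (m + r + i + 1) - c (m + r + i) ≤ c (m + i + 1) - c (m + i) :=
      hanti (show m + i ≤ m + r + i by omega)
    simpa [add_assoc] using h
  linarith

/-- **The slopes `c(n)/n` of a concave sequence vanishing at `0` are non-increasing on
`n ≥ 1`.** [folklore] -/
private theorem div_le_div_of_concave {c : ℕ → ℝ} (h0 : c 0 = 0)
    (hc : ∀ n, c n + c (n + 2) ≤ 2 * c (n + 1)) {m n : ℕ} (hm : 1 ≤ m) (hmn : m ≤ n) :
    c n / n ≤ c m / m := by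
  have hanti := sub_antitone_of_concave hc
  have key : ∀ n : ℕ, 1 ≤ n → c (n + 1) / ((n : ℝ) + 1) ≤ c n / n := by
    intro n hn
    have hnpos : (0 : ℝ) < n := by exact_mod_cast hn
    rw [div_le_div_iff₀ (by positivity) hnpos]
    have htel : c n = ∑ i ∈ range n, (c (i + 1) - c i) := by
      rw [Finset.sum_range_sub, h0, sub_zero]
    have hsum : (n : ℝ) * (c (n + 1) - c n) ≤ ∑ i ∈ range n, (c (i + 1) - c i) := by
      calc (n : ℝ) * (c (n + 1) - c n) = ∑ _i ∈ range n, (c (n + 1) - c n) := by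
            rw [Finset.sum_const, Finset.card_range, nsmul_eq_mul]
        _ ≤ ∑ i ∈ range n, (c (i + 1) - c i) :=
            Finset.sum_le_sum fun i hi => hanti (Finset.mem_range.1 hi).le
    rw [← htel] at hsum
    nlinarith
  induction n, hmn using Nat.le_induction with
  | base => exact le_rfl
  | succ n hmn ih =>
    have h := key n (le_trans hm hmn)
    push_cast
    exact h.trans ih

end RealAnalysis

/-! ### (B) Infinite-volume limit states: log-convexity in both extents, positivity -/

section Limit

variable {d N : ℕ} {G : Type*} [Group G] [TopologicalSpace G] [IsTopologicalGroup G]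
  [CompactSpace G] [MeasurableSpace G] [BorelSpace G] (ρ : G →* Matrix (Fin N) (Fin N) ℂ)

/-- **Log-convexity in the time extent, down to `T = 0`.** For an infinite-volume limit `μ` along
a subsequence of tori (`d ≥ 2`, `β ≥ 0`, continuous `ρ`), the loop expectations
`W(R,T) = W_μ(R × T)` (rectangle at the origin, `R` steps in direction `0`, `T` in direction `1`)
satisfy `0 ≤ W(R,T)` and `W(R,T+1)² ≤ W(R,T) W(R,T+2)` for all `R, T ≥ 0` — the
direction-`0` statement `rectExpectation_nonneg_and_logConvex` transported by the coordinate
swap `0 ↔ 1` (positivity of the transfer matrix in the time direction).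
[cite: SeilerLNP1982, §2 (reflection positivity and the transfer matrix)] -/
theorem rectExpectation_nonneg_and_logConvex_snd [NeZero d] (hd : 2 ≤ d) (hρ : Continuous ρ)
    {β : ℝ} (hβ : 0 ≤ β) {μ : Measure (LGConfig d G)} {φ : ℕ → ℕ} (hφ : StrictMono φ)
    (hlim : IsInfiniteVolumeLimitAlong ρ β φ μ) (R T : ℕ) :
    0 ≤ rectExpectation μ (fun g => normalisedCharacter N (ρ g)) 0 1 R T ∧
      rectExpectation μ (fun g => normalisedCharacter N (ρ g)) 0 1 R (T + 1) ^ 2 ≤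
        rectExpectation μ (fun g => normalisedCharacter N (ρ g)) 0 1 R T *
          rectExpectation μ (fun g => normalisedCharacter N (ρ g)) 0 1 R (T + 2) := by
  set χ : G → ℝ := fun g => normalisedCharacter N (ρ g) with hχ
  have hχinv : ∀ g, χ g⁻¹ = χ g := fun g => by
    simp only [hχ, normalisedCharacter,
      Literature.RepresentationTheory.CompactGroups.CompactGroup.re_trace_map_inv ρ hρ]
  set μ' := μ.map (configPermZd (Equiv.swap (0 : Fin d) 1)) with hμ'
  have hlim' : IsInfiniteVolumeLimitAlong ρ β φ μ' :=
    IsInfiniteVolumeLimitAlong.map_configPermZd ρ hρ hlim _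
  have hswap : ∀ T, rectExpectation μ χ 0 1 R T = rectExpectation μ' χ 0 1 T R := fun T =>
    rectExpectation_eq_swap μ χ hχinv R T
  rw [hswap, hswap, hswap]
  exact rectExpectation_nonneg_and_logConvex ρ hd hρ hβ hφ hlim' R T

omit [BorelSpace G] in
/-- `W_μ(R × 0) = 1` for a probability measure `μ`, continuous `ρ` and `N ≥ 1` (the degenerate
rectangle, by the coordinate swap from `rectExpectation_zero_eq_one`). [folklore] -/
private theorem rectExpectation_snd_zero_eq_one [NeZero d] (hρ : Continuous ρ) (hN : N ≠ 0)
    (μ : Measure (LGConfig d G)) [IsProbabilityMeasure μ] (R : ℕ) :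
    rectExpectation μ (fun g => normalisedCharacter N (ρ g)) 0 1 R 0 = 1 := by
  set χ : G → ℝ := fun g => normalisedCharacter N (ρ g) with hχ
  have hχinv : ∀ g, χ g⁻¹ = χ g := fun g => by
    simp only [hχ, normalisedCharacter,
      Literature.RepresentationTheory.CompactGroups.CompactGroup.re_trace_map_inv ρ hρ]
  haveI : IsProbabilityMeasure (μ.map (configPermZd (G := G) (Equiv.swap (0 : Fin d) 1))) :=
    Measure.isProbabilityMeasure_map (configPermZd _).measurable.aemeasurable
  rw [rectExpectation_eq_swap μ χ hχinv R 0]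
  exact rectExpectation_zero_eq_one ρ hN _ 0 1 R

variable [NeZero d]

omit [TopologicalSpace G] [IsTopologicalGroup G] [CompactSpace G] [BorelSpace G] in
/-- If the loop expectations `W(R,T)`, `R, T ≥ 1`, of a limit state do not vanish then `N ≥ 1`
(for `N = 0` the normalised character is the junk value `0`). [folklore] -/
private theorem card_ne_zero_of_rectExpectation_ne_zero {μ : Measure (LGConfig d G)}
    (hW : ∀ R T, 1 ≤ R → 1 ≤ T →
      rectExpectation μ (fun g => normalisedCharacter N (ρ g)) 0 1 R T ≠ 0) : N ≠ 0 := by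
  rintro rfl
  exact hW 1 1 le_rfl le_rfl (by simp [rectExpectation, loopExpectation, wilsonLoopObs,
    normalisedCharacter])

/-- **Positivity of all rectangular loop expectations of a limit state with non-vanishing
loops**: `0 < W(R,T)` for all `R, T ≥ 0` (`W ≥ 0` by reflection positivity, `≠ 0` by hypothesis
for `R, T ≥ 1`, and `= 1` on the degenerate rectangles).
[cite: SeilerLNP1982, §2 (reflection positivity and the transfer matrix)] -/
theorem rectExpectation_pos (hd : 2 ≤ d) (hρ : Continuous ρ) {β : ℝ} (hβ : 0 ≤ β)
    {μ : Measure (LGConfig d G)} (hμ : μ ∈ infiniteVolumeLimitPoints ρ β)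
    (hW : ∀ R T, 1 ≤ R → 1 ≤ T →
      rectExpectation μ (fun g => normalisedCharacter N (ρ g)) 0 1 R T ≠ 0)
    (R T : ℕ) : 0 < rectExpectation μ (fun g => normalisedCharacter N (ρ g)) 0 1 R T := by
  obtain ⟨φ, hφ, hlim⟩ := hμ
  haveI : IsProbabilityMeasure μ := hlim.1
  have hN : N ≠ 0 := card_ne_zero_of_rectExpectation_ne_zero ρ hW
  rcases Nat.eq_zero_or_pos R with rfl | hR
  · rw [rectExpectation_zero_eq_one ρ hN μ 0 1 T]
    exact one_pos
  rcases Nat.eq_zero_or_pos T with rfl | hT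
  · rw [rectExpectation_snd_zero_eq_one ρ hρ hN μ R]
    exact one_pos
  exact lt_of_le_of_ne (rectExpectation_nonneg_and_logConvex ρ hd hρ hβ hφ hlim T R).1
    (hW R T hR hT).symm

/-- **Wilson loops are bounded below by powers of thinner loops (separation direction):**
`W(1,T)^R ≤ W(R,T)` — the reflection-positivity inequality (8) of Bachas,
`W(R,T)² ≤ W(R-1,T) W(R+1,T)`, iterated from the degenerate loop `W(0,T) = 1` (a consequence, not
printed in this form). [cite: Bachas1986, eq. (8)] -/
theorem pow_le_rectExpectation_fst (hd : 2 ≤ d) (hρ : Continuous ρ) {β : ℝ} (hβ : 0 ≤ β)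
    {μ : Measure (LGConfig d G)} (hμ : μ ∈ infiniteVolumeLimitPoints ρ β)
    (hW : ∀ R T, 1 ≤ R → 1 ≤ T →
      rectExpectation μ (fun g => normalisedCharacter N (ρ g)) 0 1 R T ≠ 0)
    (R T : ℕ) :
    rectExpectation μ (fun g => normalisedCharacter N (ρ g)) 0 1 1 T ^ R ≤
      rectExpectation μ (fun g => normalisedCharacter N (ρ g)) 0 1 R T := by
  have hpos := rectExpectation_pos ρ hd hρ hβ hμ hW
  obtain ⟨φ, hφ, hlim⟩ := hμ
  haveI : IsProbabilityMeasure μ := hlim.1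
  have hN : N ≠ 0 := card_ne_zero_of_rectExpectation_ne_zero ρ hW
  exact pow_le_of_logConvex (W := fun R => rectExpectation μ _ 0 1 R T)
    (rectExpectation_zero_eq_one ρ hN μ 0 1 T) (fun R => hpos R T)
    (fun R => (rectExpectation_nonneg_and_logConvex ρ hd hρ hβ hφ hlim T R).2) R

/-- **Wilson loops are bounded below by powers of thinner loops (time direction):**
`W(R,1)^T ≤ W(R,T)` — the same inequality for the reflection in the time direction (transfer-matrix
positivity), iterated from `W(R,0) = 1` (a consequence, not printed in this form).
[cite: SeilerLNP1982, §2 (reflection positivity and the transfer matrix)] -/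
theorem pow_le_rectExpectation_snd (hd : 2 ≤ d) (hρ : Continuous ρ) {β : ℝ} (hβ : 0 ≤ β)
    {μ : Measure (LGConfig d G)} (hμ : μ ∈ infiniteVolumeLimitPoints ρ β)
    (hW : ∀ R T, 1 ≤ R → 1 ≤ T →
      rectExpectation μ (fun g => normalisedCharacter N (ρ g)) 0 1 R T ≠ 0)
    (R T : ℕ) :
    rectExpectation μ (fun g => normalisedCharacter N (ρ g)) 0 1 R 1 ^ T ≤
      rectExpectation μ (fun g => normalisedCharacter N (ρ g)) 0 1 R T := by
  have hpos := rectExpectation_pos ρ hd hρ hβ hμ hW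
  obtain ⟨φ, hφ, hlim⟩ := hμ
  haveI : IsProbabilityMeasure μ := hlim.1
  have hN : N ≠ 0 := card_ne_zero_of_rectExpectation_ne_zero ρ hW
  exact pow_le_of_logConvex (W := fun T => rectExpectation μ _ 0 1 R T)
    (rectExpectation_snd_zero_eq_one ρ hρ hN μ R) (fun T => hpos R T)
    (fun T => (rectExpectation_nonneg_and_logConvex_snd ρ hd hρ hβ hφ hlim R T).2) T

/-- **The area bound by the plaquette: `W(1,1)^{RT} ≤ W(R,T)`** — every rectangular Wilson loop
expectation of a limit state with non-vanishing loops is bounded below by the mean plaquette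
`W(1,1) = ⟨χ(U_p)⟩_μ` raised to the area (reflection positivity in both directions; a consequence of
Bachas' (8) and its time-direction twin, not printed in this form). [cite: Bachas1986, eq. (8)] -/
theorem plaquette_pow_le_rectExpectation (hd : 2 ≤ d) (hρ : Continuous ρ) {β : ℝ} (hβ : 0 ≤ β)
    {μ : Measure (LGConfig d G)} (hμ : μ ∈ infiniteVolumeLimitPoints ρ β)
    (hW : ∀ R T, 1 ≤ R → 1 ≤ T →
      rectExpectation μ (fun g => normalisedCharacter N (ρ g)) 0 1 R T ≠ 0)
    (R T : ℕ) :
    rectExpectation μ (fun g => normalisedCharacter N (ρ g)) 0 1 1 1 ^ (T * R) ≤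
      rectExpectation μ (fun g => normalisedCharacter N (ρ g)) 0 1 R T := by
  have hpos := rectExpectation_pos ρ hd hρ hβ hμ hW
  rw [pow_mul]
  exact (pow_le_pow_left₀ (pow_nonneg (hpos 1 1).le T)
    (pow_le_rectExpectation_snd ρ hd hρ hβ hμ hW 1 T) R).trans
      (pow_le_rectExpectation_fst ρ hd hρ hβ hμ hW R T)

/-! ### (C) The static potential: existence at every `R`, `V(0) = 0`, `V ≥ 0` -/

/-- **The static potential exists at every separation `R ≥ 0`** for a limit state with
non-vanishing loops, and is the tree's `staticPotential μ χ R` (`d ≥ 2`, `β ≥ 0`; the zero branch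
of the transfer-matrix dichotomy `exists_hasStaticPotential_of_subseq` is excluded by positivity).
[cite: SeilerLNP1982, §2 (static quark potential from reflection positivity)] -/
theorem hasStaticPotential_staticPotential (hd : 2 ≤ d) (hρ : Continuous ρ) {β : ℝ} (hβ : 0 ≤ β)
    {μ : Measure (LGConfig d G)} (hμ : μ ∈ infiniteVolumeLimitPoints ρ β)
    (hW : ∀ R T, 1 ≤ R → 1 ≤ T →
      rectExpectation μ (fun g => normalisedCharacter N (ρ g)) 0 1 R T ≠ 0)
    (R : ℕ) :
    HasStaticPotential μ (fun g => normalisedCharacter N (ρ g)) R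
      (staticPotential μ (fun g => normalisedCharacter N (ρ g)) R) := by
  have hpos := rectExpectation_pos ρ hd hρ hβ hμ hW
  obtain ⟨φ, hφ, hlim⟩ := hμ
  rcases exists_hasStaticPotential_of_subseq ρ hd hρ hβ hφ hlim R with h | ⟨V, -, hV⟩
  · exact absurd (h 1 le_rfl) (hpos R 1).ne'
  · rwa [hV.staticPotential_eq]

/-- **`V(R) ≥ 0`** (the loop expectations are bounded by `1`).
[cite: SeilerLNP1982, §2 (static quark potential from reflection positivity)] -/
theorem staticPotential_nonneg (hd : 2 ≤ d) (hρ : Continuous ρ) {β : ℝ} (hβ : 0 ≤ β)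
    {μ : Measure (LGConfig d G)} (hμ : μ ∈ infiniteVolumeLimitPoints ρ β)
    (hW : ∀ R T, 1 ≤ R → 1 ≤ T →
      rectExpectation μ (fun g => normalisedCharacter N (ρ g)) 0 1 R T ≠ 0)
    (R : ℕ) : 0 ≤ staticPotential μ (fun g => normalisedCharacter N (ρ g)) R := by
  have hpos := rectExpectation_pos ρ hd hρ hβ hμ hW
  obtain ⟨φ, hφ, hlim⟩ := hμ
  rcases exists_hasStaticPotential_of_subseq ρ hd hρ hβ hφ hlim R with h | ⟨V, hV0, hV⟩
  · exact absurd (h 1 le_rfl) (hpos R 1).ne'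
  · rwa [hV.staticPotential_eq]

omit [TopologicalSpace G] [IsTopologicalGroup G] [CompactSpace G] [BorelSpace G] in
/-- **`V(0) = 0`**: the degenerate loops have expectation `1` (normalisation of Bachas' `V`, eq. (5),
with the tree's normalised character). [cite: Bachas1986, eq. (5)] -/
theorem staticPotential_zero {μ : Measure (LGConfig d G)}
    [IsProbabilityMeasure μ]
    (hW : ∀ R T, 1 ≤ R → 1 ≤ T →
      rectExpectation μ (fun g => normalisedCharacter N (ρ g)) 0 1 R T ≠ 0) :
    staticPotential μ (fun g => normalisedCharacter N (ρ g)) 0 = 0 := by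
  have hN : N ≠ 0 := card_ne_zero_of_rectExpectation_ne_zero ρ hW
  have h1 : ∀ T, rectExpectation μ (fun g => normalisedCharacter N (ρ g)) 0 1 0 T = 1 :=
    fun T => rectExpectation_zero_eq_one ρ hN μ 0 1 T
  have h : HasStaticPotential μ (fun g => normalisedCharacter N (ρ g)) 0 0 := by
    refine ⟨Eventually.of_forall fun T => by rw [h1 T]; exact one_ne_zero, ?_⟩
    simp only [h1, abs_one, Real.log_one, neg_zero, zero_div]
    exact tendsto_const_nhds
  exact h.staticPotential_eq

/-- The defining limit of the static potential without the absolute value: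
`-log W(R,T) / T → V(R)` (all loops are positive; Bachas' definition (5) of `V`).
[cite: Bachas1986, eq. (5)] -/
theorem tendsto_neg_log_div_staticPotential (hd : 2 ≤ d) (hρ : Continuous ρ) {β : ℝ}
    (hβ : 0 ≤ β) {μ : Measure (LGConfig d G)} (hμ : μ ∈ infiniteVolumeLimitPoints ρ β)
    (hW : ∀ R T, 1 ≤ R → 1 ≤ T →
      rectExpectation μ (fun g => normalisedCharacter N (ρ g)) 0 1 R T ≠ 0)
    (R : ℕ) :
    Tendsto (fun T : ℕ =>
        -Real.log (rectExpectation μ (fun g => normalisedCharacter N (ρ g)) 0 1 R T) / T)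
      atTop (𝓝 (staticPotential μ (fun g => normalisedCharacter N (ρ g)) R)) := by
  have hpos := rectExpectation_pos ρ hd hρ hβ hμ hW
  refine (hasStaticPotential_staticPotential ρ hd hρ hβ hμ hW R).2.congr fun T => ?_
  rw [abs_of_pos (hpos R T)]

/-! ### (D) Bachas 1986: concavity and monotonicity; Seiler 1978: the linear upper bound -/

/-- **Bachas 1986 — the static potential is concave** (unit step): `V(R) + V(R+2) ≤ 2 V(R+1)`
for every `R ≥ 0`, `V(R) = staticPotential μ χ R`, for every infinite-volume limit point `μ` of
the torus Wilson states (compact `G`, continuous `ρ`, `χ = (1/N) Re tr ρ`, `β ≥ 0`, `d ≥ 2`) with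
non-vanishing loops. Printed: "`⟨tr U(W)⟩ ≤ ⟨tr(U(W₁)U(-θW₁))⟩^{1/2} ⟨tr(U(W₂)U(-θW₂))⟩^{1/2}` …
we then deduce immediately for all `0 < r < R` that `V(R) ≥ ½V(R-r) + ½V(R+r)`", by reflection
positivity "for a reflection about a hyperplane parallel to the (long) time axis, and normal to the
plane of the Wilson loop" — here the hyperplanes normal to direction `0`
(`rectExpectation_nonneg_and_logConvex`), including the end point `R = 0` (`V(0) = 0`).
[cite: Bachas1986, eq. (8)] -/
theorem staticPotential_concave (hd : 2 ≤ d) (hρ : Continuous ρ) {β : ℝ} (hβ : 0 ≤ β)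
    {μ : Measure (LGConfig d G)} (hμ : μ ∈ infiniteVolumeLimitPoints ρ β)
    (hW : ∀ R T, 1 ≤ R → 1 ≤ T →
      rectExpectation μ (fun g => normalisedCharacter N (ρ g)) 0 1 R T ≠ 0)
    (R : ℕ) :
    staticPotential μ (fun g => normalisedCharacter N (ρ g)) R +
        staticPotential μ (fun g => normalisedCharacter N (ρ g)) (R + 2) ≤
      2 * staticPotential μ (fun g => normalisedCharacter N (ρ g)) (R + 1) := by
  have hpos := rectExpectation_pos ρ hd hρ hβ hμ hW
  have hV := tendsto_neg_log_div_staticPotential ρ hd hρ hβ hμ hW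
  obtain ⟨φ, hφ, hlim⟩ := hμ
  set W : ℕ → ℕ → ℝ := fun R T => rectExpectation μ (fun g => normalisedCharacter N (ρ g)) 0 1 R T
    with hWdef
  have hlim₁ := (hV R).add (hV (R + 2))
  have hlim₂ := (hV (R + 1)).const_mul 2
  refine le_of_tendsto_of_tendsto hlim₁ hlim₂ ?_
  filter_upwards [eventually_ge_atTop 1] with T hT1
  have hTpos : (0 : ℝ) < T := by exact_mod_cast hT1
  have hconc := StringTension.neg_log_add_le_of_sq_le_mul (hpos R T) (hpos (R + 1) T)
    (hpos (R + 2) T) (rectExpectation_nonneg_and_logConvex ρ hd hρ hβ hφ hlim T R).2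
  rw [← add_div, mul_div_assoc']
  exact div_le_div_of_nonneg_right hconc hTpos.le

/-- **Bachas 1986 — concavity at distance `r`, as printed**: `V(R-r) + V(R+r) ≤ 2 V(R)` for
`0 ≤ r ≤ R` ("`V` is indeed a convex function of `R`" in the sign convention `V'' ≤ 0` of his
eq. (2a)). [cite: Bachas1986, eq. (8)] -/
theorem staticPotential_midpoint_concave (hd : 2 ≤ d) (hρ : Continuous ρ) {β : ℝ} (hβ : 0 ≤ β)
    {μ : Measure (LGConfig d G)} (hμ : μ ∈ infiniteVolumeLimitPoints ρ β)
    (hW : ∀ R T, 1 ≤ R → 1 ≤ T →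
      rectExpectation μ (fun g => normalisedCharacter N (ρ g)) 0 1 R T ≠ 0)
    {R r : ℕ} (hr : r ≤ R) :
    staticPotential μ (fun g => normalisedCharacter N (ρ g)) (R - r) +
        staticPotential μ (fun g => normalisedCharacter N (ρ g)) (R + r) ≤
      2 * staticPotential μ (fun g => normalisedCharacter N (ρ g)) R := by
  obtain ⟨m, rfl⟩ := Nat.exists_eq_add_of_le hr
  rw [Nat.add_sub_cancel_left, show r + m + r = m + r + r by ring, show r + m = m + r by ring]
  exact add_le_two_mul_of_concave (staticPotential_concave ρ hd hρ hβ hμ hW) m r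

/-- **Bachas 1986 — the static potential is monotone non-decreasing** ("the quark–antiquark
force is everywhere attractive", eq. (2b): `dV/dR ≥ 0`). Printed proof: concavity, and `V` is
bounded below (there by the Simon–Yaffe perimeter bound); here `V ≥ 0` since `|χ| ≤ 1`.
[cite: Bachas1986, eq. (2b)] -/
theorem staticPotential_monotone (hd : 2 ≤ d) (hρ : Continuous ρ) {β : ℝ} (hβ : 0 ≤ β)
    {μ : Measure (LGConfig d G)} (hμ : μ ∈ infiniteVolumeLimitPoints ρ β)
    (hW : ∀ R T, 1 ≤ R → 1 ≤ T →
      rectExpectation μ (fun g => normalisedCharacter N (ρ g)) 0 1 R T ≠ 0) :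
    Monotone fun R => staticPotential μ (fun g => normalisedCharacter N (ρ g)) R :=
  monotone_of_concave_nonneg (staticPotential_nonneg ρ hd hρ hβ hμ hW)
    (staticPotential_concave ρ hd hρ hβ hμ hW)

/-- **Seiler 1978 — the static potential rises at most linearly: `V(R) ≤ R · V(1)`** ("the
(suitably defined) potential between color charges cannot rise faster than linearly with
distance"; Bachas: the asymptotic form of concavity, "a slight modification of his argument").
Here: the concave sequence `V` with `V(0) = 0` lies below its first chord.
[cite: Seiler1978, abstract] -/
theorem staticPotential_le_mul (hd : 2 ≤ d) (hρ : Continuous ρ) {β : ℝ} (hβ : 0 ≤ β)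
    {μ : Measure (LGConfig d G)} (hμ : μ ∈ infiniteVolumeLimitPoints ρ β)
    (hW : ∀ R T, 1 ≤ R → 1 ≤ T →
      rectExpectation μ (fun g => normalisedCharacter N (ρ g)) 0 1 R T ≠ 0)
    (R : ℕ) :
    staticPotential μ (fun g => normalisedCharacter N (ρ g)) R ≤
      R * staticPotential μ (fun g => normalisedCharacter N (ρ g)) 1 := by
  haveI : IsProbabilityMeasure μ := by
    obtain ⟨φ, -, hlim⟩ := hμ
    exact hlim.1
  exact le_mul_of_concave (staticPotential_zero ρ hW) (staticPotential_concave ρ hd hρ hβ hμ hW) R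

/-- **The slopes `V(R)/R` are non-increasing on `R ≥ 1`** (concavity and `V(0) = 0`; the
monotone form of Seiler's bound: `V(n)/n ≤ V(m)/m ≤ V(1)` for `1 ≤ m ≤ n`; a consequence of the
printed concavity, not printed in this form). [cite: Seiler1978, abstract] -/
theorem staticPotential_div_le_div (hd : 2 ≤ d) (hρ : Continuous ρ) {β : ℝ} (hβ : 0 ≤ β)
    {μ : Measure (LGConfig d G)} (hμ : μ ∈ infiniteVolumeLimitPoints ρ β)
    (hW : ∀ R T, 1 ≤ R → 1 ≤ T →
      rectExpectation μ (fun g => normalisedCharacter N (ρ g)) 0 1 R T ≠ 0)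
    {m n : ℕ} (hm : 1 ≤ m) (hmn : m ≤ n) :
    staticPotential μ (fun g => normalisedCharacter N (ρ g)) n / n ≤
      staticPotential μ (fun g => normalisedCharacter N (ρ g)) m / m := by
  haveI : IsProbabilityMeasure μ := by
    obtain ⟨φ, -, hlim⟩ := hμ
    exact hlim.1
  exact div_le_div_of_concave (staticPotential_zero ρ hW)
    (staticPotential_concave ρ hd hρ hβ hμ hW) hm hmn

/-- **`V(R) ≤ -log W(R,1)`**: the potential at separation `R` is bounded by minus the logarithm
of the thin `R × 1` loop (log-convexity in the time direction from `T = 0`: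
`W(R,1)^T ≤ W(R,T)`). In particular `V(1) ≤ -log W(1,1) = -log ⟨χ(U_p)⟩_μ` (a consequence of the
transfer-matrix positivity, not printed in this form).
[cite: SeilerLNP1982, §2 (reflection positivity and the transfer matrix)] -/
theorem staticPotential_le_neg_log (hd : 2 ≤ d) (hρ : Continuous ρ) {β : ℝ} (hβ : 0 ≤ β)
    {μ : Measure (LGConfig d G)} (hμ : μ ∈ infiniteVolumeLimitPoints ρ β)
    (hW : ∀ R T, 1 ≤ R → 1 ≤ T →
      rectExpectation μ (fun g => normalisedCharacter N (ρ g)) 0 1 R T ≠ 0)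
    (R : ℕ) :
    staticPotential μ (fun g => normalisedCharacter N (ρ g)) R ≤
      -Real.log (rectExpectation μ (fun g => normalisedCharacter N (ρ g)) 0 1 R 1) := by
  have hpos := rectExpectation_pos ρ hd hρ hβ hμ hW
  have hpow := pow_le_rectExpectation_snd ρ hd hρ hβ hμ hW R
  refine le_of_tendsto (tendsto_neg_log_div_staticPotential ρ hd hρ hβ hμ hW R) ?_
  filter_upwards [eventually_ge_atTop 1] with T hT1
  have hTpos : (0 : ℝ) < T := by exact_mod_cast hT1
  rw [div_le_iff₀ hTpos]
  have hlog := Real.log_le_log (pow_pos (hpos R 1) T) (hpow T)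
  rw [Real.log_pow] at hlog
  linarith

/-! ### (E) The string tension: canonical value and upper bounds -/

/-- **The string tension exists and is the tree's `stringTension μ χ`** for a limit state with
non-vanishing loops: `V(R)/R → σ = stringTension μ χ ≥ 0` (the non-negative concave sequence `V`
has a linear rate, `StringTension.tendsto_div_of_concave_nonneg`; cf. the named fact
`exists_hasStringTension`, proved in `LatticeGaugeStringTensionProofs` by the same mechanism).
[cite: SeilerLNP1982, §2 (string tension from reflection positivity)] -/
theorem stringTension_nonneg_and_hasStringTension (hd : 2 ≤ d) (hρ : Continuous ρ) {β : ℝ}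
    (hβ : 0 ≤ β) {μ : Measure (LGConfig d G)} (hμ : μ ∈ infiniteVolumeLimitPoints ρ β)
    (hW : ∀ R T, 1 ≤ R → 1 ≤ T →
      rectExpectation μ (fun g => normalisedCharacter N (ρ g)) 0 1 R T ≠ 0) :
    0 ≤ stringTension μ (fun g => normalisedCharacter N (ρ g)) ∧
      HasStringTension μ (fun g => normalisedCharacter N (ρ g))
        (stringTension μ (fun g => normalisedCharacter N (ρ g))) := by
  set V : ℕ → ℝ := fun R => staticPotential μ (fun g => normalisedCharacter N (ρ g)) R with hVdef
  obtain ⟨σ, hσ0, hσ⟩ := StringTension.tendsto_div_of_concave_nonneg (b := V)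
    (fun R _ => staticPotential_nonneg ρ hd hρ hβ hμ hW R)
    (fun R _ => staticPotential_concave ρ hd hρ hβ hμ hW R)
  have h : HasStringTension μ (fun g => normalisedCharacter N (ρ g)) σ :=
    ⟨V, fun R _ => hasStaticPotential_staticPotential ρ hd hρ hβ hμ hW R, hσ⟩
  rw [h.stringTension_eq]
  exact ⟨hσ0, h⟩

/-- **`σ ≤ V(R)/R` for every `R ≥ 1`** (the slopes decrease to the string tension), in
particular **`σ ≤ V(1)`** — the string-tension form of Seiler's linear upper bound (a consequence).
[cite: Seiler1978, abstract] -/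
theorem stringTension_le_staticPotential_div (hd : 2 ≤ d) (hρ : Continuous ρ) {β : ℝ}
    (hβ : 0 ≤ β) {μ : Measure (LGConfig d G)} (hμ : μ ∈ infiniteVolumeLimitPoints ρ β)
    (hW : ∀ R T, 1 ≤ R → 1 ≤ T →
      rectExpectation μ (fun g => normalisedCharacter N (ρ g)) 0 1 R T ≠ 0)
    {R : ℕ} (hR : 1 ≤ R) :
    stringTension μ (fun g => normalisedCharacter N (ρ g)) ≤
      staticPotential μ (fun g => normalisedCharacter N (ρ g)) R / R := by
  obtain ⟨-, V, hV, hσ⟩ := stringTension_nonneg_and_hasStringTension ρ hd hρ hβ hμ hW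
  have hVeq : ∀ n, 1 ≤ n → V n = staticPotential μ (fun g => normalisedCharacter N (ρ g)) n :=
    fun n hn => ((hV n hn).staticPotential_eq).symm
  refine le_of_tendsto hσ ?_
  filter_upwards [eventually_ge_atTop R] with n hn
  rw [hVeq n (le_trans hR hn)]
  exact staticPotential_div_le_div ρ hd hρ hβ hμ hW hR hn

/-- **`σ ≤ V(1)`.** [cite: Seiler1978, abstract] -/
theorem stringTension_le_staticPotential_one (hd : 2 ≤ d) (hρ : Continuous ρ) {β : ℝ}
    (hβ : 0 ≤ β) {μ : Measure (LGConfig d G)} (hμ : μ ∈ infiniteVolumeLimitPoints ρ β)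
    (hW : ∀ R T, 1 ≤ R → 1 ≤ T →
      rectExpectation μ (fun g => normalisedCharacter N (ρ g)) 0 1 R T ≠ 0) :
    stringTension μ (fun g => normalisedCharacter N (ρ g)) ≤
      staticPotential μ (fun g => normalisedCharacter N (ρ g)) 1 := by
  simpa using stringTension_le_staticPotential_div ρ hd hρ hβ hμ hW (le_refl 1)

/-- **The string tension is bounded by minus the logarithm of the mean plaquette:**
`σ ≤ -log W(1,1) = -log ⟨χ(U_p)⟩_μ` (reflection positivity in both directions; every compact `G`,
continuous `ρ`, `β ≥ 0`, `d ≥ 2`, every limit state with non-vanishing loops). This — and not a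
comparison with the one-plaquette (two-dimensional) value — is the infinite-volume inequality the
tree proves; see the module docstring (a consequence of Seiler's bound and transfer-matrix
positivity, not printed in this form). [cite: Seiler1978, abstract] -/
theorem stringTension_le_neg_log_plaquette (hd : 2 ≤ d) (hρ : Continuous ρ) {β : ℝ}
    (hβ : 0 ≤ β) {μ : Measure (LGConfig d G)} (hμ : μ ∈ infiniteVolumeLimitPoints ρ β)
    (hW : ∀ R T, 1 ≤ R → 1 ≤ T →
      rectExpectation μ (fun g => normalisedCharacter N (ρ g)) 0 1 R T ≠ 0) :
    stringTension μ (fun g => normalisedCharacter N (ρ g)) ≤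
      -Real.log (rectExpectation μ (fun g => normalisedCharacter N (ρ g)) 0 1 1 1) :=
  (stringTension_le_staticPotential_one ρ hd hρ hβ hμ hW).trans
    (staticPotential_le_neg_log ρ hd hρ hβ hμ hW 1)

/-! ### (F) Finite-`T` upper bounds: the effective potential decreases to `V(R)` -/

omit [NeZero d] in
/-- The successive ratios `W(n+1)/W(n)` of a positive log-convex sequence bounded by `1` are at
most `1` (a ratio `> 1` would persist and make the sequence unbounded). [folklore] -/
private theorem div_le_one_of_logConvex {W : ℕ → ℝ} (hpos : ∀ n, 0 < W n) (hle : ∀ n, W n ≤ 1)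
    (hconv : ∀ n, W (n + 1) ^ 2 ≤ W n * W (n + 2)) (n : ℕ) : W (n + 1) / W n ≤ 1 := by
  by_contra h
  rw [not_le] at h
  set r : ℝ := W (n + 1) / W n with hr
  have hgeom : ∀ m : ℕ, W n * r ^ m ≤ W (n + m) := by
    intro m
    induction m with
    | zero => simp
    | succ m ih =>
      have hmono : r ≤ W (n + m + 1) / W (n + m) :=
        div_monotone_of_logConvex hpos hconv (Nat.le_add_right n m)
      have hnm : W (n + m) ≠ 0 := (hpos (n + m)).ne'
      calc W n * r ^ (m + 1) = W n * r ^ m * r := by ring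
        _ ≤ W (n + m) * (W (n + m + 1) / W (n + m)) :=
            mul_le_mul ih hmono (zero_le_one.trans h.le) (hpos (n + m)).le
        _ = W (n + (m + 1)) := by rw [← add_assoc]; field_simp
  obtain ⟨m, hm⟩ := pow_unbounded_of_one_lt (1 / W n) h
  have h1 : 1 < W n * r ^ m := by
    have := mul_lt_mul_of_pos_left hm (hpos n)
    rwa [mul_one_div_cancel (hpos n).ne'] at this
  linarith [hgeom m, hle (n + m)]

omit [NeZero d] in
/-- Geometric lower bound from an arbitrary starting index: `W(n) (W(n+1)/W(n))^m ≤ W(n+m)` for a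
positive log-convex sequence. [folklore] -/
private theorem mul_pow_div_le_of_logConvex {W : ℕ → ℝ} (hpos : ∀ n, 0 < W n)
    (hconv : ∀ n, W (n + 1) ^ 2 ≤ W n * W (n + 2)) (n m : ℕ) :
    W n * (W (n + 1) / W n) ^ m ≤ W (n + m) := by
  induction m with
  | zero => simp
  | succ m ih =>
    have hmono : W (n + 1) / W n ≤ W (n + m + 1) / W (n + m) :=
      div_monotone_of_logConvex hpos hconv (Nat.le_add_right n m)
    have hnm : W (n + m) ≠ 0 := (hpos (n + m)).ne'
    calc W n * (W (n + 1) / W n) ^ (m + 1) = W n * (W (n + 1) / W n) ^ m * (W (n + 1) / W n) := by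
          ring
      _ ≤ W (n + m) * (W (n + m + 1) / W (n + m)) :=
          mul_le_mul ih hmono (div_nonneg (hpos (n + 1)).le (hpos n).le) (hpos (n + m)).le
      _ = W (n + (m + 1)) := by rw [← add_assoc]; field_simp

/-- **Rectangular Wilson loop expectations decrease in the time extent: `W(R,T+1) ≤ W(R,T)`**
(transfer-matrix positivity: the ratios `W(R,T+1)/W(R,T)` increase in `T` and the loops are
bounded by `1`; a consequence, not printed in this form).
[cite: SeilerLNP1982, §2 (reflection positivity and the transfer matrix)] -/
theorem rectExpectation_succ_snd_le (hd : 2 ≤ d) (hρ : Continuous ρ) {β : ℝ} (hβ : 0 ≤ β)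
    {μ : Measure (LGConfig d G)} (hμ : μ ∈ infiniteVolumeLimitPoints ρ β)
    (hW : ∀ R T, 1 ≤ R → 1 ≤ T →
      rectExpectation μ (fun g => normalisedCharacter N (ρ g)) 0 1 R T ≠ 0)
    (R T : ℕ) :
    rectExpectation μ (fun g => normalisedCharacter N (ρ g)) 0 1 R (T + 1) ≤
      rectExpectation μ (fun g => normalisedCharacter N (ρ g)) 0 1 R T := by
  have hpos := rectExpectation_pos ρ hd hρ hβ hμ hW
  obtain ⟨φ, hφ, hlim⟩ := hμ
  haveI : IsProbabilityMeasure μ := hlim.1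
  have h := div_le_one_of_logConvex (W := fun T => rectExpectation μ _ 0 1 R T)
    (fun T => hpos R T)
    (fun T => (le_abs_self _).trans (StringTension.abs_rectExpectation_le_one ρ hρ μ R T))
    (fun T => (rectExpectation_nonneg_and_logConvex_snd ρ hd hρ hβ hφ hlim R T).2) T
  rwa [div_le_one (hpos R T)] at h

/-- **Rectangular Wilson loop expectations decrease in the separation: `W(R+1,T) ≤ W(R,T)`**
(the same in the direction `0`; a consequence, not printed in this form). [cite: Bachas1986, eq. (8)] -/
theorem rectExpectation_succ_fst_le (hd : 2 ≤ d) (hρ : Continuous ρ) {β : ℝ} (hβ : 0 ≤ β)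
    {μ : Measure (LGConfig d G)} (hμ : μ ∈ infiniteVolumeLimitPoints ρ β)
    (hW : ∀ R T, 1 ≤ R → 1 ≤ T →
      rectExpectation μ (fun g => normalisedCharacter N (ρ g)) 0 1 R T ≠ 0)
    (R T : ℕ) :
    rectExpectation μ (fun g => normalisedCharacter N (ρ g)) 0 1 (R + 1) T ≤
      rectExpectation μ (fun g => normalisedCharacter N (ρ g)) 0 1 R T := by
  have hpos := rectExpectation_pos ρ hd hρ hβ hμ hW
  obtain ⟨φ, hφ, hlim⟩ := hμ
  haveI : IsProbabilityMeasure μ := hlim.1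
  have h := div_le_one_of_logConvex (W := fun R => rectExpectation μ _ 0 1 R T)
    (fun R => hpos R T)
    (fun R => (le_abs_self _).trans (StringTension.abs_rectExpectation_le_one ρ hρ μ R T))
    (fun R => (rectExpectation_nonneg_and_logConvex ρ hd hρ hβ hφ hlim T R).2) R
  rwa [div_le_one (hpos R T)] at h

/-- **The effective potential bounds `V(R)` from above at every finite `T`:**
`V(R) ≤ log W(R,T) - log W(R,T+1) = -log (W(R,T+1)/W(R,T))` for all `R, T ≥ 0` (the ratios
`W(R,T+1)/W(R,T)` increase in `T` to `e^{-V(R)}`; at `T = 0` this is `V(R) ≤ -log W(R,1)`). The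
lattice practitioner's "effective masses approach their plateau from above", for the static
potential of every infinite-volume limit state with non-vanishing loops (a consequence of
transfer-matrix positivity, not printed in this form).
[cite: SeilerLNP1982, §2 (reflection positivity and the transfer matrix)] -/
theorem staticPotential_le_log_sub_log (hd : 2 ≤ d) (hρ : Continuous ρ) {β : ℝ} (hβ : 0 ≤ β)
    {μ : Measure (LGConfig d G)} (hμ : μ ∈ infiniteVolumeLimitPoints ρ β)
    (hW : ∀ R T, 1 ≤ R → 1 ≤ T →
      rectExpectation μ (fun g => normalisedCharacter N (ρ g)) 0 1 R T ≠ 0)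
    (R T : ℕ) :
    staticPotential μ (fun g => normalisedCharacter N (ρ g)) R ≤
      Real.log (rectExpectation μ (fun g => normalisedCharacter N (ρ g)) 0 1 R T) -
        Real.log (rectExpectation μ (fun g => normalisedCharacter N (ρ g)) 0 1 R (T + 1)) := by
  have hpos := rectExpectation_pos ρ hd hρ hβ hμ hW
  have hV := tendsto_neg_log_div_staticPotential ρ hd hρ hβ hμ hW R
  obtain ⟨φ, hφ, hlim⟩ := hμ
  set W : ℕ → ℝ := fun S => rectExpectation μ (fun g => normalisedCharacter N (ρ g)) 0 1 R S
    with hWdef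
  have hWpos : ∀ S, 0 < W S := fun S => hpos R S
  set r : ℝ := W (T + 1) / W T with hr
  have hrpos : 0 < r := div_pos (hWpos (T + 1)) (hWpos T)
  -- geometric lower bound from index `T`: `W T * r ^ m ≤ W (T + m)`
  have hgeom : ∀ m : ℕ, W T * r ^ m ≤ W (T + m) := fun m =>
    mul_pow_div_le_of_logConvex hWpos
      (fun S => (rectExpectation_nonneg_and_logConvex_snd ρ hd hρ hβ hφ hlim R S).2) T m
  -- hence `-log W(S)/S ≤ (-log W(T) + T log r)/S - log r` for `S ≥ T`, and the right side → -log r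
  have hup : Tendsto (fun S : ℕ => (-Real.log (W T) + T * Real.log r) / (S : ℝ) + -Real.log r)
      atTop (𝓝 (0 + -Real.log r)) :=
    (tendsto_const_div_atTop_nhds_zero_nat _).add tendsto_const_nhds
  rw [zero_add] at hup
  have hle : -Real.log r = Real.log (W T) - Real.log (W (T + 1)) := by
    rw [hr, Real.log_div (hWpos (T + 1)).ne' (hWpos T).ne']
    ring
  rw [← hle]
  refine le_of_tendsto_of_tendsto hV hup ?_
  filter_upwards [eventually_ge_atTop (T + 1)] with S hS
  obtain ⟨m, rfl⟩ := Nat.exists_eq_add_of_le (show T ≤ S by omega)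
  have hSpos : (0 : ℝ) < ((T + m : ℕ) : ℝ) := by exact_mod_cast (show 0 < T + m by omega)
  have hlog := Real.log_le_log (mul_pos (hWpos T) (pow_pos hrpos m)) (hgeom m)
  rw [Real.log_mul (hWpos T).ne' (pow_pos hrpos m).ne', Real.log_pow] at hlog
  rw [div_add' _ _ _ hSpos.ne', div_le_div_iff_of_pos_right hSpos]
  push_cast
  nlinarith [hlog]

/-- **The effective potentials decrease in `T`**: `T ↦ log W(R,T) - log W(R,T+1)` is
non-increasing (equivalently the ratios `W(R,T+1)/W(R,T)` are non-decreasing: log-convexity in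
the time extent). [cite: SeilerLNP1982, §2 (reflection positivity and the transfer matrix)] -/
theorem log_sub_log_antitone (hd : 2 ≤ d) (hρ : Continuous ρ) {β : ℝ} (hβ : 0 ≤ β)
    {μ : Measure (LGConfig d G)} (hμ : μ ∈ infiniteVolumeLimitPoints ρ β)
    (hW : ∀ R T, 1 ≤ R → 1 ≤ T →
      rectExpectation μ (fun g => normalisedCharacter N (ρ g)) 0 1 R T ≠ 0)
    (R : ℕ) :
    Antitone fun T : ℕ =>
      Real.log (rectExpectation μ (fun g => normalisedCharacter N (ρ g)) 0 1 R T) -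
        Real.log (rectExpectation μ (fun g => normalisedCharacter N (ρ g)) 0 1 R (T + 1)) := by
  have hpos := rectExpectation_pos ρ hd hρ hβ hμ hW
  obtain ⟨φ, hφ, hlim⟩ := hμ
  have hmono := div_monotone_of_logConvex (W := fun T => rectExpectation μ _ 0 1 R T)
    (fun T => hpos R T) (fun T => (rectExpectation_nonneg_and_logConvex_snd ρ hd hρ hβ hφ hlim R T).2)
  intro S T hST
  have h := Real.log_le_log (div_pos (hpos R (S + 1)) (hpos R S)) (hmono hST)
  simp only at h
  rw [Real.log_div (hpos R (S + 1)).ne' (hpos R S).ne',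
    Real.log_div (hpos R (T + 1)).ne' (hpos R T).ne'] at h
  linarith

end Limit

end StaticPotential

end Literature.MathematicalPhysics.QuantumFieldTheory
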